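import Mathlib
import HarnessLib
import Summits.HubbardSuperconductivity.HubbardSuperconductivity.Theorems.KLProgrammeKLRegimeCountertermJacksonFrame

/-!
# Route `KLProgramme`, crux K3 — gen-5 ENGINE child (`stub_twoLeg_step`, (E3a-MS) supplier, recipe (L)+(F), plan g12 STATUS l.1769):
# DEFINITIONS of the Jackson frequency split — the smoothing square's measure and weight, and the low / high parts
# `jlow d F := 2𝒥_dF − 𝒥_d(𝒥_dF)`, `jhigh d F := (1 − 𝒥_d)²F`

Seat hubbard-kl-k3c3-p1 (g3), package (P1) of MS-DESIGN-NOTE §3–§4 (evidence #29 on stmt-…-19855).  The (F) step of the (E3a-MS) witness splits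
each mean-free deep frame piece `g` at degree `d = 4ⁿ` into a LOW part (a trigonometric polynomial of degree `2d`, every derivative costing
`≲ d`) and a HIGH part (small in sup norm by `d^{−l}‖Dˡg‖`, `l ≤ 4`).  With k3c3-p2's Jackson mean `𝒥_d = jsmooth d` (positive kernel of mass
one, `…CountertermJacksonFrame`), the split that achieves order 4 with a POSITIVE kernel is the iterate: `high := (1 − 𝒥_d)²`,
`low := 1 − (1 − 𝒥_d)² = 2𝒥_d − 𝒥_d²`.  This file only NAMES the objects (the bounds are `…JacksonTranslate` / `…JacksonHighPart`):

* `jmeas` — the product measure on the smoothing square `(−π, π]²` (an `abbrev`: finiteness is inferred); `jweight d (s,t) := J̃_d(s)·J̃_d(t)`;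
  `jshift (s,t) := toLp (s,t) ∈ ℝ²` (Euclidean) — the data of the weighted-translate presentation `𝒥_dF(q) = ∫ jweight·(F∘ofLp)(q − jshift) d jmeas`
  (`jsmooth_eq_integral_translate`);
* `jhigh1 d F := F − 𝒥_dF`, `jhigh d F := jhigh1 d (jhigh1 d F)`, `jlow d F := 2𝒥_dF − 𝒥_d(𝒥_dF)`.

Definitions and `rfl`-level lemmas only; pure real analysis, nothing about the model.
-/

noncomputable section

namespace Summit.HubbardSuperconductivity.HubbardSuperconductivity.Theorems.KLRegimeSplit

set_option linter.dupNamespace false -- summit = problem name (single-conjunct summit), D-0017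

open Real MeasureTheory
open Literature.MathematicalPhysics.QuantumLattice

/-- **The smoothing square's measure**: Lebesgue measure on `(−π, π] × (−π, π]` as a product of restrictions (finite; `abbrev` so that
`IsFiniteMeasure` is found by instance search). -/
abbrev jmeas : Measure (ℝ × ℝ) := (volume.restrict (Set.Ioc (-π) π)).prod (volume.restrict (Set.Ioc (-π) π))

/-- **The Jackson product weight** `J̃_d(s)·J̃_d(t)`. -/
abbrev jweight (d : ℕ) (w : ℝ × ℝ) : ℝ := jker d w.1 * jker d w.2

/-- **The translate vector** `(s,t) ↦ (s,t) ∈ ℝ²` (Euclidean). -/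
abbrev jshift (w : ℝ × ℝ) : EuclideanSpace ℝ (Fin 2) := WithLp.toLp 2 ![w.1, w.2]

/-- **`jhigh1 d F := F − 𝒥_d F`** (one application of `1 − 𝒥_d`). -/
def jhigh1 (d : ℕ) (F : (Fin 2 → ℝ) → ℝ) : (Fin 2 → ℝ) → ℝ := fun p => F p - jsmooth d F p

/-- **`jhigh d F := (1 − 𝒥_d)² F`** — the HIGH part of the frequency split at degree `d`. -/
def jhigh (d : ℕ) (F : (Fin 2 → ℝ) → ℝ) : (Fin 2 → ℝ) → ℝ := jhigh1 d (jhigh1 d F)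

/-- **`jlow d F := 2𝒥_d F − 𝒥_d(𝒥_d F)`** — the LOW part (a trigonometric polynomial of degree `2d` when `F` is a symmetric frame). -/
def jlow (d : ℕ) (F : (Fin 2 → ℝ) → ℝ) : (Fin 2 → ℝ) → ℝ := fun p => 2 * jsmooth d F p - jsmooth d (jsmooth d F) p

/-- Unfolding `jhigh1`. -/
theorem jhigh1_apply (d : ℕ) (F : (Fin 2 → ℝ) → ℝ) (p : Fin 2 → ℝ) : jhigh1 d F p = F p - jsmooth d F p := rfl

/-- Unfolding `jhigh`. -/
theorem jhigh_eq (d : ℕ) (F : (Fin 2 → ℝ) → ℝ) : jhigh d F = jhigh1 d (jhigh1 d F) := rfl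

/-- Unfolding `jlow`. -/
theorem jlow_apply (d : ℕ) (F : (Fin 2 → ℝ) → ℝ) (p : Fin 2 → ℝ) :
    jlow d F p = 2 * jsmooth d F p - jsmooth d (jsmooth d F) p := rfl

/-- The weight is nonnegative. -/
theorem jweight_nonneg (d : ℕ) (w : ℝ × ℝ) : 0 ≤ jweight d w := mul_nonneg (jker_nonneg d _) (jker_nonneg d _)

end Summit.HubbardSuperconductivity.HubbardSuperconductivity.Theorems.KLRegimeSplit

end
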